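import Summits.NavierStokesRegularity.NavierStokesRegularity.Theorems.LandauTailHomSteadyProfileExistsProfile
import Literature.Analysis.FluidPDE.HelmholtzAnnihilator
import Literature.Analysis.FluidPDE.SverakLandauRegularize

/-!
# Route `LandauTail`, item `HomSteadyProfileExists` (stmt-NavierStokesRegularity-1951) — helper 3:
# Landau's theorem — `(U·∇)U + ∇P = ΔU` off the origin for `landauAxisField` / `landauAxisPressure`

Support file (`--supports stmt-NavierStokesRegularity-1951`). Notation as in the sibling files
(`…Calculus`, `…Profile`): `U = landauAxisField a c = (P/2) x + β a`, `P = landauAxisPressure a c`,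
`β = 2/(c|x| − ⟪a,x⟫)`, `|a| = 1`, `|c| > 1`, everything at a point `x ≠ 0` of `ℝ³`.

* `laplacian_landauAxisPressure`: **`ΔP = β ∂ₐP − P²/2`**. Since `P = −2∂ₐβ` near `x`, this is
  `∂ₐ` applied to the second-order identity `Δβ = β ∂ₐβ` (`laplacian_landauBeta`):
  `ΔP = −2∂ₐΔβ = −2∂ₐ(β∂ₐβ) = −2(∂ₐβ)² − 2β ∂ₐ∂ₐβ = −P²/2 + β∂ₐP`. To commute `Δ` with `∂ₐ` we
  replace `β` by a globally smooth function agreeing with it on `{|y| > |x|/2}`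
  (`Sverak2011.exists_contDiff_eq_of_contDiffOn`) and use the tree's `fderiv_laplacian_apply`.
* `laplacian_landauAxisField`: Leibniz, `ΔU = (ΔP/2) x + ∇P + (Δβ) a`.
* `landauAxisField_momentum`: **Landau's theorem** (Landau 1944; Lemarié-Rieusset 2016,
  Thm 10.13; Karch–Pilarczyk 2011, §1: `v_c, p_c` "satisfy (1.1) with `F ≡ 0` in the pointwise
  sense for every `x ∈ ℝ³ ∖ {0}`"): `(U·∇)U + ∇P = ΔU` at every `x ≠ 0`; both sides equal
  `(−P²/4 + β∂ₐP/2) x + ∇P − (Pβ/2) a`.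

References: L. D. Landau, Dokl. Akad. Nauk SSSR 43 (1944) 286–288; P. G. Lemarié-Rieusset,
*The Navier–Stokes problem in the 21st century* (2016), Thm 10.13; G. Karch, D. Pilarczyk,
Arch. Ration. Mech. Anal. 202 (2011), §1.
-/

noncomputable section

open Set Filter Module
open scoped Laplacian InnerProductSpace RealInnerProductSpace Topology ContDiff
open Literature.Analysis.PDE.LoewnerNirenberg Literature.Analysis.FluidPDE

-- the summit namespace `…NavierStokesRegularity.NavierStokesRegularity…` is the tree convention
set_option linter.dupNamespace false

namespace Summit.NavierStokesRegularity.NavierStokesRegularity.Theorems.LandauTail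

variable {a : EuclideanSpace ℝ (Fin 3)} {c : ℝ} {x : EuclideanSpace ℝ (Fin 3)}

/-- `Δβ = −βP/2` at `x ≠ 0` (the identity `Δβ = β∂ₐβ` with `∂ₐβ = −P/2`). [folklore] -/
theorem laplacian_landauBeta_eq (ha : ‖a‖ = 1) (hc : 1 < |c|) (hx : x ≠ 0) :
    (Δ (fun y : EuclideanSpace ℝ (Fin 3) => 2 / (c * ‖y‖ - ⟪a, y⟫))) x =
      -(2 / (c * ‖x‖ - ⟪a, x⟫) * (2⁻¹ * landauAxisPressure a c x)) := by
  rw [laplacian_landauBeta ha hc hx, fderiv_landauBeta_axis ha hc hx, mul_neg]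

/-- **`ΔP = β ∂ₐP − P²/2`** for the Landau pressure at `x ≠ 0`: differentiate `Δβ = β ∂ₐβ` along
the axis and use `P = −2∂ₐβ`, after replacing `β` by a globally smooth function that agrees with
it on `{|y| > |x|/2}` (so that `Δ ∂ₐ = ∂ₐ Δ` is the tree's global lemma). [folklore] -/
theorem laplacian_landauAxisPressure (ha : ‖a‖ = 1) (hc : 1 < |c|) (hx : x ≠ 0) :
    (Δ (landauAxisPressure a c)) x =
      2 / (c * ‖x‖ - ⟪a, x⟫) * fderiv ℝ (landauAxisPressure a c) x a -
        2⁻¹ * landauAxisPressure a c x ^ 2 := by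
  -- the cut-off radius and the punctured neighbourhood `S = {δ < |y|}` of `x`
  set δ : ℝ := ‖x‖ / 2 with hδ_def
  have hxn : 0 < ‖x‖ := norm_pos_iff.2 hx
  have hδ : 0 < δ := by positivity
  have hxS : δ < ‖x‖ := by rw [hδ_def]; linarith
  have hS : IsOpen {y : EuclideanSpace ℝ (Fin 3) | δ < ‖y‖} :=
    isOpen_lt continuous_const continuous_norm
  have hS0 : ∀ y : EuclideanSpace ℝ (Fin 3), δ < ‖y‖ → y ≠ 0 := fun y hy h => by
    rw [h, norm_zero] at hy
    exact absurd hy (not_lt.2 hδ.le)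
  -- a globally smooth `B` agreeing with `β` on `{δ ≤ |y|}`
  have hβon : ContDiffOn ℝ ∞ (fun y : EuclideanSpace ℝ (Fin 3) => 2 / (c * ‖y‖ - ⟪a, y⟫))
      {y | y ≠ 0} := fun y hy => (contDiffAt_landauBeta ha hc hy).contDiffWithinAt
  obtain ⟨B, hB, hBβ⟩ := Sverak2011.exists_contDiff_eq_of_contDiffOn hβon hδ
  have hev : ∀ {y : EuclideanSpace ℝ (Fin 3)}, δ < ‖y‖ →
      B =ᶠ[𝓝 y] fun y : EuclideanSpace ℝ (Fin 3) => 2 / (c * ‖y‖ - ⟪a, y⟫) := fun hy =>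
    Sverak2011.eventuallyEq_of_eq_of_le_norm hBβ hy
  -- smoothness data of `B`
  have hB3 : ContDiff ℝ 3 B := contDiff_infty.1 hB 3
  have hBd : ∀ y, DifferentiableAt ℝ B y := fun y => (hB.differentiable (by simp)) y
  have hBa : ContDiff ℝ 2 (fun y => fderiv ℝ B y a) :=
    (hB3.fderiv_right (m := 2) le_rfl).clm_apply contDiff_const
  have hBad : ∀ y, DifferentiableAt ℝ (fun y => fderiv ℝ B y a) y := fun y =>
    (hBa.differentiable (by simp)) y
  -- transfer of the first-order identities to `B` on `S`: `DB = Dβ`, `P = −2 ∂ₐB`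
  have hf1 : ∀ {y : EuclideanSpace ℝ (Fin 3)}, δ < ‖y‖ →
      fderiv ℝ B y = fderiv ℝ (fun y : EuclideanSpace ℝ (Fin 3) => 2 / (c * ‖y‖ - ⟪a, y⟫)) y :=
    fun hy => (hev hy).fderiv_eq
  have hPB : ∀ {y : EuclideanSpace ℝ (Fin 3)}, δ < ‖y‖ →
      landauAxisPressure a c y = -2 * fderiv ℝ B y a := by
    intro y hy
    rw [hf1 hy, fderiv_landauBeta_axis ha hc (hS0 y hy)]
    ring
  have hPev : landauAxisPressure a c =ᶠ[𝓝 x] fun y => -2 * fderiv ℝ B y a := by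
    filter_upwards [hS.mem_nhds hxS] with y hy using hPB hy
  -- transfer of `Δβ = β ∂ₐβ` to `B` on `S`
  have hΔB : ∀ {y : EuclideanSpace ℝ (Fin 3)}, δ < ‖y‖ → (Δ B) y = B y * fderiv ℝ B y a := by
    intro y hy
    rw [(InnerProductSpace.laplacian_congr_nhds (hev hy)).eq_of_nhds, hBβ y hy.le, hf1 hy]
    exact laplacian_landauBeta ha hc (hS0 y hy)
  have hΔBev : (Δ B) =ᶠ[𝓝 x] fun y => B y * fderiv ℝ B y a := by
    filter_upwards [hS.mem_nhds hxS] with y hy using hΔB hy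
  -- `ΔP = −2 ∂ₐ ΔB`
  have h1 : (Δ (landauAxisPressure a c)) x = -2 * fderiv ℝ (Δ B) x a := by
    rw [(InnerProductSpace.laplacian_congr_nhds hPev).eq_of_nhds]
    have hsm : (fun y => -2 * fderiv ℝ B y a) = (-2 : ℝ) • fun y => fderiv ℝ B y a := by
      funext y
      simp [smul_eq_mul]
    rw [hsm, InnerProductSpace.laplacian_smul (-2 : ℝ) hBa.contDiffAt, smul_eq_mul,
      fderiv_laplacian_apply hB3]
  -- `∂ₐ ΔB = ∂ₐ (B ∂ₐB) = (∂ₐB)² + B ∂ₐ∂ₐB`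
  have h2 : fderiv ℝ (Δ B) x a =
      fderiv ℝ B x a * fderiv ℝ B x a + B x * fderiv ℝ (fun y => fderiv ℝ B y a) x a := by
    rw [hΔBev.fderiv_eq, fderiv_fun_mul (hBd x) (hBad x)]
    simp only [add_apply, smul_apply, smul_eq_mul]
    ring
  -- `∂ₐ∂ₐB = −∂ₐP/2`
  have h3 : fderiv ℝ (fun y => fderiv ℝ B y a) x a =
      -(2⁻¹ * fderiv ℝ (landauAxisPressure a c) x a) := by
    have hQ : (fun y => fderiv ℝ B y a) =ᶠ[𝓝 x] fun y => (-2⁻¹ : ℝ) * landauAxisPressure a c y := by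
      filter_upwards [hS.mem_nhds hxS] with y hy
      rw [hPB hy]
      ring
    rw [hQ.fderiv_eq, fderiv_const_mul (differentiableAt_landauAxisPressure ha hc hx)]
    simp only [smul_apply, smul_eq_mul]
    ring
  rw [h1, h2, h3, hBβ x hxS.le, hf1 hxS, fderiv_landauBeta_axis ha hc hx]
  ring

/-- **The Laplacian of Landau's solution** at `x ≠ 0` (Leibniz rule on `U = (P/2) x + β a`):
`ΔU = (ΔP/2) x + ∇P + (Δβ) a`. [folklore] -/
theorem laplacian_landauAxisField (ha : ‖a‖ = 1) (hc : 1 < |c|) (hx : x ≠ 0) :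
    (Δ (landauAxisField a c)) x =
      (2⁻¹ * (Δ (landauAxisPressure a c)) x) • x + gradient (landauAxisPressure a c) x +
        ((Δ (fun y : EuclideanSpace ℝ (Fin 3) => 2 / (c * ‖y‖ - ⟪a, y⟫))) x) • a := by
  set b := EuclideanSpace.basisFun (Fin 3) ℝ
  have hP2 : ContDiffAt ℝ 2 (landauAxisPressure a c) x := contDiffAt_landauAxisPressure ha hc hx
  have hf2 : ContDiffAt ℝ 2 (fun y => 2⁻¹ * landauAxisPressure a c y) x := contDiffAt_const.mul hP2
  have hβ2 : ContDiffAt ℝ 2 (fun y : EuclideanSpace ℝ (Fin 3) => 2 / (c * ‖y‖ - ⟪a, y⟫)) x :=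
    contDiffAt_landauBeta ha hc hx
  have hsplit : landauAxisField a c =
      (fun y => (2⁻¹ * landauAxisPressure a c y) • y) +
        fun y : EuclideanSpace ℝ (Fin 3) => (2 / (c * ‖y‖ - ⟪a, y⟫)) • a :=
    (landauAxisField_eq ha hc).trans rfl
  have hA : ContDiffAt ℝ 2 (fun y => (2⁻¹ * landauAxisPressure a c y) • y) x :=
    hf2.smul contDiffAt_id
  have hB : ContDiffAt ℝ 2 (fun y : EuclideanSpace ℝ (Fin 3) => (2 / (c * ‖y‖ - ⟪a, y⟫)) • a) x :=
    hβ2.smul contDiffAt_const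
  rw [hsplit, hA.laplacian_add hB,
    laplacian_smul_apply (g := fun y => y) hf2 contDiffAt_id b, laplacian_fun_id, smul_zero,
    add_zero, laplacian_smul_apply (g := fun _ => a) hβ2 contDiffAt_const b]
  -- the pieces
  have hΔf : (Δ (fun y => 2⁻¹ * landauAxisPressure a c y)) x =
      2⁻¹ * (Δ (landauAxisPressure a c)) x := by
    have hsm : (fun y => 2⁻¹ * landauAxisPressure a c y) = (2⁻¹ : ℝ) • landauAxisPressure a c := by
      funext y; simp [smul_eq_mul]
    rw [hsm, InnerProductSpace.laplacian_smul (2⁻¹ : ℝ) hP2, smul_eq_mul]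
  have hDf : ∀ i, fderiv ℝ (fun y => 2⁻¹ * landauAxisPressure a c y) x (b i) =
      2⁻¹ * fderiv ℝ (landauAxisPressure a c) x (b i) := fun i => by
    rw [fderiv_const_mul (differentiableAt_landauAxisPressure ha hc hx)]
    simp only [smul_apply, smul_eq_mul]
  have hconst : (Δ (fun _ : EuclideanSpace ℝ (Fin 3) => a)) x = 0 := by
    simp only [InnerProductSpace.laplacian_const, Pi.zero_apply]
  simp only [fderiv_fun_id, ContinuousLinearMap.id_apply, hDf, hΔf, fderiv_fun_const, Pi.zero_apply,
    zero_apply, smul_zero, Finset.sum_const_zero, add_zero, hconst]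
  rw [gradient_eq_sum_fderiv_smul b (landauAxisPressure a c) x, Finset.smul_sum]
  congr 1
  congr 1
  exact Finset.sum_congr rfl fun i _ => by rw [smul_smul]; congr 1; ring

/-- **Landau's theorem** (Landau 1944; Squire 1951; Lemarié-Rieusset 2016, Thm 10.13;
Karch–Pilarczyk 2011, §1): for a unit axis `a` and `|c| > 1`, Landau's solution
`U = landauAxisField a c` with pressure `P = landauAxisPressure a c` solves the steady
Navier–Stokes equations with viscosity `1` and no force at every `x ≠ 0`:
`(U·∇)U + ∇P = ΔU`. Both sides equal `(−P²/4 + β∂ₐP/2) x + ∇P − (Pβ/2) a`. [folklore] -/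
theorem landauAxisField_momentum (ha : ‖a‖ = 1) (hc : 1 < |c|) (hx : x ≠ 0) :
    convect (landauAxisField a c) (landauAxisField a c) x + gradient (landauAxisPressure a c) x =
      (Δ (landauAxisField a c)) x := by
  rw [convect_landauAxisField ha hc hx, laplacian_landauAxisField ha hc hx,
    laplacian_landauAxisPressure ha hc hx, laplacian_landauBeta_eq ha hc hx]
  ext i
  simp only [PiLp.add_apply, PiLp.smul_apply, PiLp.sub_apply, smul_eq_mul]
  ring

end Summit.NavierStokesRegularity.NavierStokesRegularity.Theorems.LandauTail
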